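import Summits.BirchSwinnertonDyer.Rank1Residual.GaloisImage.PropagatedConditionCoisotropic
import Summits.BirchSwinnertonDyer.Rank1Residual.GaloisImage.PropagatedConditionKummer
import Summits.BirchSwinnertonDyer.Rank1Residual.GaloisImage.PropagatedStructureCartesian
import HarnessLib

/-!
# Residual coisotropy (Sakamoto 2024 Def. 3.8) of the Mazur–Rubin PROPAGATED canonical structure
# `𝓕_can` and of the INDUCED structures along `[k] : E[kd] → E[d]` (Kim's classical structure, the
# finite-level propagated structures) — cell `b2b-bsdres`, team n1011, sub-target T-a3-F1
# (hypothesis side of Sakamoto 2024 Thm. 4.4 at `p = 3`), deal R5-3 (p18); sibling of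
# `PropagatedConditionCoisotropic.lean` and `PropagatedConditionKummer.lean`

HONEST FRAMING (cell `b2b-bsdres`, run/shared/lean/b2b/bsd-rank1-residual/, verbatim in every
file): the goal of the cell is to DELETE the COMBINATION-SHAPED residual classes of the
Birch–Swinnerton-Dyer formula for ALL analytic-rank `≤ 1` elliptic curves over `ℚ` — "full BSD
formula for every rank `≤ 1` curve in class `C`" assembled STRICTLY from published theorems — so
that the rank-`≤ 1` remainder becomes exactly the CONSTRUCTION-SHAPED classes, which are TYPED
(missing-input `Prop`s), NOT attempted. This is not "finishing BSD". Team n1011 (N10/N11, the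
additive block `X4 ∧ p = 3`): research route; no claim beyond the stated classes; the label X4 and
the mark of RESIDUAL-MAP §I N11 are UNCHANGED by this file; nothing is booked. HYPOTHESIS-side
theorems only: no definition, no named fact (Tate's local Euler–Poincaré characteristic is the
tree's named fact `localEulerPoincareCharacteristic K_v`, an explicit hypothesis as in the sibling).

## What this file proves and why

Sakamoto, JTNB 36 (2024) Thm. 4.4 is applied (Kim, arXiv:2505.09121 §3; skeleton T-a3 §6) to
`T = E[p^m]` with residual representation `T̄ = E[p]`, the reduction `T ↠ T̄` being multiplication
by `p^{m-1}` — in the tree `WeierstrassCurve.torsionMulBy k d : E[kd] → E[d]` (`k = p^{m-1}`,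
`d = p`) — and the hypothesis "residually coisotropic" (Def. 3.8) concerns the INDUCED structure
`𝓕̄_v = [k]_* 𝓕_v` (`SelmerStructure.induced`, Sakamoto §2 p. 921).  The sibling file proves Def. 3.8
for every local condition on `E[d]` containing the local Kummer condition; this file supplies the
containment for induced structures:

* **(Instances: induced structures.)** Along the change of level `[k] : E[kd] → E[d]`
  (`WeierstrassCurve.torsionMulBy`, Sakamoto's reduction `T = E[p^m] ↠ T̄ = E[p]` for `k = p^{m-1}`,
  `d = p`), the induced ("residual") structure `𝓗̄_v = [k]_* 𝓗_v` (`SelmerStructure.induced`) of ANY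
  structure `𝓗` on `E[kd]` containing the level-`kd` Kummer condition contains the level-`d` Kummer
  condition (`kummerSelmerStructure_le_induced_torsionMulBy`: every local Kummer class at level `d`
  lifts to one at level `kd`, the tree's divisible lift `exists_map_torsionMulBy_localKummerClass_eq`,
  Milne I §6 proof of Prop. 6.9), with equality for `𝓗 =` the Kummer structure itself
  (`induced_kummerSelmerStructure_torsionMulBy`).  Hence the residual coisotropy of Thm. 4.4 holds
  for (a) Kim's classical structure `𝓕_cl` = Kummer conditions on `E[p^m]` (Kim, AJM 148 §2.1;
  Sakamoto 2022 App. §5 `𝓖 = 𝓕_cl`), (b) the level-`kd` relaxed/propagated structure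
  `im(H¹(K_v, E[kd]) → H¹(K_v, E[d]))`, and (c) any structure between; the Mazur–Rubin structure
  propagated from `T_pE` is the next bullet.

* **(THE TARGET OF T-a3-F1's coisotropy clause.)** For `E/ℚ`, a prime `p` (odd) and Mazur–Rubin's
  canonical structure PROPAGATED from `T_pE` (p13's `propagatedSelmerStructure W p k` on
  `E[p^{k+1}]`, whose residual structure is `propagatedSelmerStructureOne W p` on `E[p]` for every
  `k` — `induced_propagatedSelmerStructure`, `PropagatedStructureCartesian.lean`):
  `inv.IsResiduallyCoisotropic (propagatedSelmerStructureOne W p) w S` for the Poitou–Tate family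
  `inv`, every finite set of places `S`, given Tate's local Euler–Poincaré characteristic at the
  finite places of `S` (`isResiduallyCoisotropic_propagatedSelmerStructureOne`, `…_three`; and, in
  the literal hypothesis shape `inv.IsResiduallyCoisotropic (𝓕.induced red) θ S` of the tree's fact
  `Sakamoto2024.kolyvaginSystems_freeRankOne_zmod_three_pow` with `𝓕 = propagatedSelmerStructure W p k`,
  `red = [p^k]`: `isResiduallyCoisotropic_induced_propagatedSelmerStructure`, `…_three`): the
  sibling's `isResiduallyCoisotropic_of_kummer_le` fed with `𝓛_v ≤ 𝓕_can(E[p])_v`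
  (`kummerSelmerStructure_le_propagatedSelmerStructureOne`, the `p`-adic Kummer lift,
  `PropagatedConditionKummer.lean` — the declaration of record by lead ruling R5-22 (a); p13's
  `PropagatedStructureKummer.lean` declares the same name and must NEVER be imported together with
  it: consumers of the level-one inclusion import `PropagatedConditionKummer`, consumers of the
  level-`k` inclusion / the `T_pE` Kummer-lift API import p13's file).  With p13's
  cartesian theorem and the core-rank count this completes the hypothesis "cartesian, `χ = 1`,
  residually coisotropic" of Sakamoto's Thm. 4.4 for `(E[3^{k+1}], 𝓕_can)` under NO local-torsion
  and NO Tamagawa hypothesis (skeleton T-a3 v2 §6 (a)–(d)).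

References: R. Sakamoto, JTNB 36 (2024) 919–946, §2, Def. 3.8, Thm. 4.4 [Sakamoto2024]; R. Sakamoto,
Doc. Math. 27 (2022) App. §5 (`𝓖 = 𝓕_cl`); C.-H. Kim, Amer. J. Math. 148 (2026) §2.1
[Kim2022StructureSelmer]; J. S. Milne, *Arithmetic Duality Theorems* (2006) I §6, proof of
Prop. 6.9 [MilneADT2006].
-/

noncomputable section

open scoped Classical

universe u

namespace Summit.BirchSwinnertonDyer.Rank1Residual.GaloisImage

open CategoryTheory WeierstrassCurve Field Function NumberField IsDedekindDomain
open Literature.NumberTheory.EllipticCurves Literature.NumberTheory.GaloisRepresentations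
open Literature.NumberTheory.GaloisCohomology
open Literature.NumberTheory.GaloisRepresentations.DiscreteGaloisModule (mu MuCarrier tateDual
  SelmerStructure localMap)
open scoped ContRepresentation

attribute [local instance] absoluteGaloisGroup_compactSpace
attribute [local instance] finite_geomTorsion_of_neZero
  Literature.NumberTheory.EllipticCurves.finite_muCarrier

/-! ## Instances: induced structures along the change of level `[k] : E[kd] → E[d]` -/

section Induced

variable {K : Type u} [Field K] [NumberField K] (W : WeierstrassCurve K) [W.IsElliptic]

/-- **The induced ("residual") structure of a structure containing the Kummer conditions contains
the Kummer conditions.**  For `k d ≠ 0`, a place `v`, and a local condition `𝓗_v ≤ H¹(K_v, E[kd])`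
containing the level-`kd` local Kummer condition: the image `[k]_* 𝓗_v ≤ H¹(K_v, E[d])` along
`[k] : E[kd] → E[d]` (`WeierstrassCurve.torsionMulBy`; `SelmerStructure.induced`, Sakamoto's `𝓕̄`
for `T = E[p^m] ↠ T̄ = E[p]`) contains the level-`d` local Kummer condition: every local Kummer
class `κ_d(Q)` (`d • Q ∈ E(K_v)`) is `[k]_* κ_{kd}(Q₁)` with `k • Q₁ = Q` (divisibility of
`E(K̄_v)`; tree `exists_map_torsionMulBy_localKummerClass_eq`, Milne I §6 proof of Prop. 6.9,
"lift `b_v` to `b_{v,1} ∈ H¹(G_v, A_{m²})` in the image of `A(K_v)`").  Any Tamagawa number, any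
local torsion, finite or infinite `v`. [cite: MilneADT2006, Ch. I §6, proof of Prop. 6.9]
[cite: Sakamoto2024, §2 (p. 921), the induced Selmer structure] -/
theorem kummerSelmerStructure_le_induced_torsionMulBy (k d : ℤ) (hkd : k * d ≠ 0)
    (𝓗 : SelmerStructure (W.torsionGaloisModule (k * d))) (v : Place K)
    (h𝓗 : W.kummerSelmerStructure (k * d) v ≤ 𝓗 v) :
    W.kummerSelmerStructure d v ≤ 𝓗.induced (W.torsionMulBy k d) v := by
  have hd : d ≠ 0 := right_ne_zero_of_mul hkd
  intro x hx
  obtain ⟨Q, hQ, rfl⟩ :=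
    (W.mem_kummerLocalConditionAt_iff_exists_eq_localKummerClass d (E := Place.Completion v) hd x).mp
      hx
  obtain ⟨Q₁, hQ₁, -, hmap⟩ :=
    W.exists_map_torsionMulBy_localKummerClass_eq k d hkd hd (E := Place.Completion v) Q hQ
  rw [SelmerStructure.mem_induced_iff]
  exact ⟨W.localKummerClass (k * d) hkd Q₁ hQ₁,
    h𝓗 (W.localKummerClass_mem_kummerLocalConditionAt (k * d) hkd Q₁ hQ₁), hmap⟩

/-- **The induced structure of the Kummer structure is the Kummer structure**:
`[k]_* 𝓛_{kd,v} = 𝓛_{d,v}` at every place (`⊇` by the divisible lift, `⊆` by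
`[k]_* κ_{kd}(Q) = κ_d(k • Q)`, tree `map_torsionMulBy_localKummerClass`).  For Kim's classical
structure `𝓕_cl` (Kummer conditions on `E[p^m]`, Kim AJM 148 §2.1; Sakamoto 2022 App. §5) this
computes Sakamoto's residual structure: `𝓕̄_cl` = the Kummer structure on `E[p]`.
[cite: MilneADT2006, Ch. I §6, proof of Prop. 6.9] [cite: Sakamoto2024, §2 (p. 921)] -/
theorem induced_kummerSelmerStructure_torsionMulBy (k d : ℤ) (hkd : k * d ≠ 0) (v : Place K) :
    (W.kummerSelmerStructure (k * d)).induced (W.torsionMulBy k d) v = W.kummerSelmerStructure d v := by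
  have hd : d ≠ 0 := right_ne_zero_of_mul hkd
  refine le_antisymm ?_ (kummerSelmerStructure_le_induced_torsionMulBy W k d hkd _ v le_rfl)
  intro x hx
  rw [SelmerStructure.mem_induced_iff] at hx
  obtain ⟨y, hy, rfl⟩ := hx
  obtain ⟨Q, hQ, rfl⟩ :=
    (W.mem_kummerLocalConditionAt_iff_exists_eq_localKummerClass (k * d) (E := Place.Completion v)
      hkd y).mp hy
  have hQ' : d • (k • Q) ∈ MulAction.fixedPoints (absoluteGaloisGroup (Place.Completion v))
      (localPoints W (Place.Completion v)) := by
    rw [smul_smul, mul_comm]; exact hQ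
  change galoisCohomology.map ((W.torsionMulBy k d).restrictField (Place.Completion v)) 1
    (W.localKummerClass (k * d) hkd Q hQ) ∈ W.kummerSelmerStructure d v
  rw [W.map_torsionMulBy_localKummerClass k d hkd hd Q hQ hQ']
  exact W.localKummerClass_mem_kummerLocalConditionAt d hd (k • Q) hQ'

end Induced

/-! ## Coisotropy of induced structures: Kim's classical structure and the propagated structures -/

section InducedCoisotropic

variable {K : Type u} [Field K] [NumberField K] (W : WeierstrassCurve K) (p : ℕ) [NeZero p]
  [W.IsElliptic]
variable (e : geomTorsion W p → geomTorsion W p → AlgebraicClosure K)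
  (hμ : ∀ S T, e S T ^ p = 1)
  (hadd₁ : ∀ S₁ S₂ T, e (S₁ + S₂) T = e S₁ T * e S₂ T)
  (hadd₂ : ∀ S T₁ T₂, e S (T₁ + T₂) = e S T₁ * e S T₂)
  (hgal : ∀ (σ : absoluteGaloisGroup K) (S T : geomTorsion W p), σ • e S T = e (σ • S) (σ • T))

/-- **Residual coisotropy of the induced structure of ANY structure containing the Kummer
conditions** (Sakamoto Def. 3.8 for `T = E[kp] ↠ T̄ = E[p]`, `red = [k]`): for `k ≠ 0`, `p` an odd
prime power (in the source the prime `3`), a structure `𝓗` on `E[kp]` whose local condition at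
every finite place of `S` contains the level-`kp` Kummer condition, the Poitou–Tate family `inv`
(`IsPerfect`) and the local Euler characteristic at the finite places of `S`:
`inv.IsResiduallyCoisotropic (𝓗.induced [k]) w S`.  Covers (a) `𝓗 =` Kim's classical structure
`𝓕_cl` (Kummer at every place), (b) `𝓗 = ⊤` (the level-`kp` propagated structure
`im(H¹(K_v, E[kp]) → H¹(K_v, E[p]))`), (c) anything between, e.g. Kummer away from `p` and relaxed
at `p`. [cite: Sakamoto2024, Def. 3.8 (p. 924) and Thm. 4.4 (p. 926)] -/
theorem isResiduallyCoisotropic_induced_of_kummer_le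
    (halt : ∀ T, e T T = 1) (hnondeg : ∀ T, (∀ S, e S T = 1) → T = 0) (hp : IsPrimePow p)
    (hodd : Odd p) (inv : LocalInvariants K p) (hinv : inv.IsPerfect) (S : Finset (Place K))
    (hEP : ∀ v : HeightOneSpectrum (𝓞 K), (Sum.inr v : Place K) ∈ S →
      localEulerPoincareCharacteristic (v.adicCompletion K))
    (k : ℤ) (hk : k ≠ 0) (𝓗 : SelmerStructure (W.torsionGaloisModule (k * p)))
    (h𝓗 : ∀ v : HeightOneSpectrum (𝓞 K), (Sum.inr v : Place K) ∈ S →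
      W.kummerSelmerStructure (k * p) (Sum.inr v) ≤ 𝓗 (Sum.inr v)) :
    inv.IsResiduallyCoisotropic (𝓗.induced (W.torsionMulBy k p))
      (weilDualIntertwining W p e hμ hadd₁ hadd₂ hgal) S := by
  have hkp : k * (p : ℤ) ≠ 0 := mul_ne_zero hk (Int.natCast_ne_zero.mpr (NeZero.ne p))
  exact isResiduallyCoisotropic_of_kummer_le W p e hμ hadd₁ hadd₂ hgal halt hnondeg hp hodd inv hinv
    S hEP _ fun v hv =>
      kummerSelmerStructure_le_induced_torsionMulBy W k p hkp 𝓗 (Sum.inr v) (h𝓗 v hv)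

/-- **Kim's classical structure is residually coisotropic** (case (a): `𝓗 =` the Kummer structure
on `E[kp]`, whose residual structure IS the Kummer structure on `E[p]` by
`induced_kummerSelmerStructure_torsionMulBy`).  Sakamoto 2022 App. §5 (`𝓖 = 𝓕_cl` residually
self-dual); Kim AJM 148 §2.1. [cite: Sakamoto2024, Def. 3.8 (p. 924)] -/
theorem isResiduallyCoisotropic_induced_kummerSelmerStructure
    (halt : ∀ T, e T T = 1) (hnondeg : ∀ T, (∀ S, e S T = 1) → T = 0) (hp : IsPrimePow p)
    (hodd : Odd p) (inv : LocalInvariants K p) (hinv : inv.IsPerfect) (S : Finset (Place K))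
    (hEP : ∀ v : HeightOneSpectrum (𝓞 K), (Sum.inr v : Place K) ∈ S →
      localEulerPoincareCharacteristic (v.adicCompletion K))
    (k : ℤ) (hk : k ≠ 0) :
    inv.IsResiduallyCoisotropic ((W.kummerSelmerStructure (k * p)).induced (W.torsionMulBy k p))
      (weilDualIntertwining W p e hμ hadd₁ hadd₂ hgal) S :=
  isResiduallyCoisotropic_induced_of_kummer_le W p e hμ hadd₁ hadd₂ hgal halt hnondeg hp hodd inv
    hinv S hEP k hk _ fun _ _ => le_rfl

/-- **The level-`kp` propagated (everywhere relaxed) structure is residually coisotropic** (case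
(b): `𝓗 = ⊤`, residual structure `im(H¹(K_v, E[kp]) → H¹(K_v, E[p]))` at every place).
[cite: Sakamoto2024, Def. 3.8 (p. 924)] -/
theorem isResiduallyCoisotropic_induced_top
    (halt : ∀ T, e T T = 1) (hnondeg : ∀ T, (∀ S, e S T = 1) → T = 0) (hp : IsPrimePow p)
    (hodd : Odd p) (inv : LocalInvariants K p) (hinv : inv.IsPerfect) (S : Finset (Place K))
    (hEP : ∀ v : HeightOneSpectrum (𝓞 K), (Sum.inr v : Place K) ∈ S →
      localEulerPoincareCharacteristic (v.adicCompletion K))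
    (k : ℤ) (hk : k ≠ 0) :
    inv.IsResiduallyCoisotropic
      ((⊤ : SelmerStructure (W.torsionGaloisModule (k * p))).induced (W.torsionMulBy k p))
      (weilDualIntertwining W p e hμ hadd₁ hadd₂ hgal) S :=
  isResiduallyCoisotropic_induced_of_kummer_le W p e hμ hadd₁ hadd₂ hgal halt hnondeg hp hodd inv
    hinv S hEP k hk _ fun _ _ => le_top

end InducedCoisotropic

/-! ## The Mazur–Rubin propagated canonical structure `𝓕_can` is residually coisotropic -/

section Canonical

-- `[NeZero p]` (implied by `Fact p.Prime`) is carried as an instance argument for the Weil-pairing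
-- vocabulary on `E[p]`; at `p = 3` both instances are Mathlib's.
variable (W : WeierstrassCurve ℚ) [W.IsElliptic] (p : ℕ) [hp : Fact p.Prime] [NeZero p]
variable (e : geomTorsion W p → geomTorsion W p → AlgebraicClosure ℚ)
  (hμ : ∀ S T, e S T ^ p = 1)
  (hadd₁ : ∀ S₁ S₂ T, e (S₁ + S₂) T = e S₁ T * e S₂ T)
  (hadd₂ : ∀ S T₁ T₂, e S (T₁ + T₂) = e S T₁ * e S T₂)
  (hgal : ∀ (σ : absoluteGaloisGroup ℚ) (S T : geomTorsion W p), σ • e S T = e (σ • S) (σ • T))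

/-- **`𝓕_can` IS RESIDUALLY COISOTROPIC (Sakamoto 2024 Def. 3.8) — the coisotropy clause of the
hypothesis of Thm. 4.4 for `(E[p^{k+1}], 𝓕_can)`, every `k`.**  For an elliptic curve `E = W` over
`ℚ`, an odd prime `p`, a Weil pairing `e` on `E[p]` (alternating, non-degenerate, `Γ_ℚ`-equivariant,
`μ_p`-valued — the shape of the tree's `exists_weilPairing_holds`), the Poitou–Tate family of local
invariant maps `inv` (`LocalInvariants.IsPerfect`, from the fact `poitouTate_selmerStructure_duality`),
a finite set of places `S`, and Tate's local Euler–Poincaré characteristic at the finite places of `S`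
(the tree's named fact `localEulerPoincareCharacteristic ℚ_v`, Milne I Thm. 2.8):

  `inv.IsResiduallyCoisotropic (propagatedSelmerStructureOne W p) w S`,

`w` the Weil dual map `E[p] → E[p]^∨(1)` ((H.SD)) and `propagatedSelmerStructureOne W p` =
`im(H¹(ℚ_v, T_pE) → H¹(ℚ_v, E[p]))` at every `v` = the residual structure `𝓕̄_can` of
`propagatedSelmerStructure W p k` for every `k` (p13, `induced_propagatedSelmerStructure`).  Proof:
`𝓛_v ≤ 𝓕_can(E[p])_v` at every place (`kummerSelmerStructure_le_propagatedSelmerStructureOne`, the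
`p`-adic Kummer lift) and every local condition containing the Kummer condition is residually
coisotropic (`isResiduallyCoisotropic_of_kummer_le`).  NO hypothesis on `E(ℚ_v)[p]`, on the
reduction type or on the Tamagawa numbers (contrast Sakamoto's Lemma 9.3 for the structure of his
Def. 9.2).  Skeleton T-a3 v2 §6 (a). [cite: Sakamoto2024, Def. 3.8 (p. 924) and Thm. 4.4 (p. 926)]
[cite: MilneADT2006, Ch. I, Cor. 3.4, Thm. 2.8 and Lemma 6.15] -/
theorem isResiduallyCoisotropic_propagatedSelmerStructureOne
    (halt : ∀ T, e T T = 1) (hnondeg : ∀ T, (∀ S, e S T = 1) → T = 0) (hodd : Odd p)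
    (inv : LocalInvariants ℚ p) (hinv : inv.IsPerfect) (S : Finset (Place ℚ))
    (hEP : ∀ v : HeightOneSpectrum (𝓞 ℚ), (Sum.inr v : Place ℚ) ∈ S →
      localEulerPoincareCharacteristic (v.adicCompletion ℚ)) :
    inv.IsResiduallyCoisotropic (propagatedSelmerStructureOne W p)
      (weilDualIntertwining W p e hμ hadd₁ hadd₂ hgal) S :=
  isResiduallyCoisotropic_of_kummer_le W p e hμ hadd₁ hadd₂ hgal halt hnondeg hp.out.isPrimePow hodd
    inv hinv S hEP _ fun v _ => kummerSelmerStructure_le_propagatedSelmerStructureOne W p (Sum.inr v)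

/-- The same with the Euler characteristic assumed at every finite place, for every `S`.
[cite: Sakamoto2024, Def. 3.8 (p. 924)] -/
theorem isResiduallyCoisotropic_propagatedSelmerStructureOne'
    (halt : ∀ T, e T T = 1) (hnondeg : ∀ T, (∀ S, e S T = 1) → T = 0) (hodd : Odd p)
    (inv : LocalInvariants ℚ p) (hinv : inv.IsPerfect)
    (hEP : ∀ v : HeightOneSpectrum (𝓞 ℚ), localEulerPoincareCharacteristic (v.adicCompletion ℚ))
    (S : Finset (Place ℚ)) :
    inv.IsResiduallyCoisotropic (propagatedSelmerStructureOne W p)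
      (weilDualIntertwining W p e hμ hadd₁ hadd₂ hgal) S :=
  isResiduallyCoisotropic_propagatedSelmerStructureOne W p e hμ hadd₁ hadd₂ hgal halt hnondeg hodd inv
    hinv S fun v _ => hEP v

/-- **Residual coisotropy of `𝓕_can` at a single finite place `v`** (the place-wise form; only the
injectivity of `inv_v` and the Euler characteristic at `v` are used; every prime `p`, odd or not).
[cite: Sakamoto2024, Def. 3.8 (p. 924)] -/
theorem isResiduallyCoisotropicAt_propagatedSelmerStructureOne_inr
    (halt : ∀ T, e T T = 1) (hnondeg : ∀ T, (∀ S, e S T = 1) → T = 0)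
    (v : HeightOneSpectrum (𝓞 ℚ)) (hEP : localEulerPoincareCharacteristic (v.adicCompletion ℚ))
    (inv : LocalInvariants ℚ p) (hinv : Function.Injective (inv (Sum.inr v))) :
    inv.IsResiduallyCoisotropicAt (propagatedSelmerStructureOne W p)
      (weilDualIntertwining W p e hμ hadd₁ hadd₂ hgal) (Sum.inr v) :=
  isResiduallyCoisotropicAt_inr_of_kummer_le W p e hμ hadd₁ hadd₂ hgal halt hnondeg hp.out.isPrimePow v
    hEP inv hinv _ (kummerSelmerStructure_le_propagatedSelmerStructureOne W p (Sum.inr v))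

/-- **The coisotropy hypothesis of the typed fact, literally.**  In the hypothesis shape
`inv.IsResiduallyCoisotropic (𝓕.induced red) θ S` of the tree's fact
`Sakamoto2024.kolyvaginSystems_freeRankOne_zmod_three_pow` (p254540), with Sakamoto's
`T = E[p^{k+1}]`, `𝓕 = propagatedSelmerStructure W p k` and `red = [p^k]`
(`WeierstrassCurve.torsionMulBy`): the residual structure is `propagatedSelmerStructureOne W p`
(p13's `induced_propagatedSelmerStructure`), which is residually coisotropic by
`isResiduallyCoisotropic_propagatedSelmerStructureOne`.  Every `k`.
[cite: Sakamoto2024, Def. 3.8 (p. 924) and Thm. 4.4 (p. 926)] -/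
theorem isResiduallyCoisotropic_induced_propagatedSelmerStructure
    (halt : ∀ T, e T T = 1) (hnondeg : ∀ T, (∀ S, e S T = 1) → T = 0) (hodd : Odd p)
    (inv : LocalInvariants ℚ p) (hinv : inv.IsPerfect) (S : Finset (Place ℚ))
    (hEP : ∀ v : HeightOneSpectrum (𝓞 ℚ), (Sum.inr v : Place ℚ) ∈ S →
      localEulerPoincareCharacteristic (v.adicCompletion ℚ)) (k : ℕ) :
    inv.IsResiduallyCoisotropic
      ((propagatedSelmerStructure W p k).induced (W.torsionMulBy ((p : ℤ) ^ k) (p : ℤ)))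
      (weilDualIntertwining W p e hμ hadd₁ hadd₂ hgal) S := by
  rw [induced_propagatedSelmerStructure]
  exact isResiduallyCoisotropic_propagatedSelmerStructureOne W p e hμ hadd₁ hadd₂ hgal halt hnondeg
    hodd inv hinv S hEP

end Canonical

/-! ### `p = 3`: the N11 instance -/

section Three

variable (W : WeierstrassCurve ℚ) [W.IsElliptic]
variable (e : geomTorsion W (3 : ℕ) → geomTorsion W (3 : ℕ) → AlgebraicClosure ℚ)
  (hμ : ∀ S T, e S T ^ (3 : ℕ) = 1)
  (hadd₁ : ∀ S₁ S₂ T, e (S₁ + S₂) T = e S₁ T * e S₂ T)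
  (hadd₂ : ∀ S T₁ T₂, e S (T₁ + T₂) = e S T₁ * e S T₂)
  (hgal : ∀ (σ : absoluteGaloisGroup ℚ) (S T : geomTorsion W (3 : ℕ)), σ • e S T = e (σ • S) (σ • T))

/-- **Sakamoto's hypothesis "residually coisotropic" holds for `(E[3^{k+1}], 𝓕_can)` on the N11 rows**
(`p = 3`; every `k`, every local torsion `E(ℚ₃)[3]`, every Tamagawa number): the residual structure
`𝓕̄_can = propagatedSelmerStructureOne W 3` is residually coisotropic on every finite set of places
`S`, for the Poitou–Tate family `inv` at level `3` and the Weil self-duality of `E[3]`, given Tate's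
local Euler characteristic at the finite places of `S`.  Skeleton T-a3 v2 §6 (a); with p13's
`isCartesian_propagatedSelmerStructure_three` and the core-rank clause, the structural hypotheses of
[S24] Thm. 4.4 for the N11 chain. [cite: Sakamoto2024, Def. 3.8 (p. 924) and Thm. 4.4 (p. 926)] -/
theorem isResiduallyCoisotropic_propagatedSelmerStructureOne_three
    (halt : ∀ T, e T T = 1) (hnondeg : ∀ T, (∀ S, e S T = 1) → T = 0)
    (inv : LocalInvariants ℚ 3) (hinv : inv.IsPerfect) (S : Finset (Place ℚ))
    (hEP : ∀ v : HeightOneSpectrum (𝓞 ℚ), (Sum.inr v : Place ℚ) ∈ S →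
      localEulerPoincareCharacteristic (v.adicCompletion ℚ)) :
    inv.IsResiduallyCoisotropic (propagatedSelmerStructureOne W 3)
      (weilDualIntertwining W 3 e hμ hadd₁ hadd₂ hgal) S :=
  isResiduallyCoisotropic_propagatedSelmerStructureOne W 3 e hμ hadd₁ hadd₂ hgal halt hnondeg
    (by decide) inv hinv S hEP

/-- The same in the fact's literal hypothesis shape, `T = E[3^{k+1}]`, `red = [3^k]`, every `k`:
`inv.IsResiduallyCoisotropic ((propagatedSelmerStructure W 3 k).induced [3^k]) w S`.
[cite: Sakamoto2024, Def. 3.8 (p. 924) and Thm. 4.4 (p. 926)] -/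
theorem isResiduallyCoisotropic_induced_propagatedSelmerStructure_three
    (halt : ∀ T, e T T = 1) (hnondeg : ∀ T, (∀ S, e S T = 1) → T = 0)
    (inv : LocalInvariants ℚ 3) (hinv : inv.IsPerfect) (S : Finset (Place ℚ))
    (hEP : ∀ v : HeightOneSpectrum (𝓞 ℚ), (Sum.inr v : Place ℚ) ∈ S →
      localEulerPoincareCharacteristic (v.adicCompletion ℚ)) (k : ℕ) :
    inv.IsResiduallyCoisotropic
      ((propagatedSelmerStructure W 3 k).induced (W.torsionMulBy (((3 : ℕ) : ℤ) ^ k) ((3 : ℕ) : ℤ)))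
      (weilDualIntertwining W 3 e hμ hadd₁ hadd₂ hgal) S :=
  isResiduallyCoisotropic_induced_propagatedSelmerStructure W 3 e hμ hadd₁ hadd₂ hgal halt hnondeg
    (by decide) inv hinv S hEP k

end Three

end Summit.BirchSwinnertonDyer.Rank1Residual.GaloisImage

end
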